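import Literature.IUT.HodgeArakelov.LabelClassesOfCusps
import HarnessLib

/-!
# [IUTchII] Def 2.3 (i): `[Π̂^cor_v : Π̂^±_v] = 2l` for EVERY `±`-tower — the `Π`-index from the printed `Δ`-index

S. Mochizuki, *Inter-universal Teichmüller theory II*, kurims manuscript (Dec. 2020), §2 Def 2.3 (i) p. 67: «`Δ̂_v` [is] a normal
open subgroup of `Δ̂^±_v` of index `l`, … `Δ̂^±_v` [is] a normal open subgroup of `Δ̂^cor_v` of index `2l`», and Def 2.3 (v) p. 69:
«`Δ̂^cor_v/Δ̂^±_v ⥲ Π̂^cor_v/Π̂^±_v ⥲ 𝔽_l^{⋊±}`» [claim: Mochizuki2012, status: disputed] (IUTchII §2 Def 2.3 (i), kurims p.67) (D-0012 claim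
key; record-only; nothing printed is asserted here).

abc-iut cell, seat abc-iut-w5-d243 gen 4; PROOF-ONLY interface theorems over abc-iut-L6-t1's `PlusMinusTower T` (`LabelClassesOfCusps.lean`,
untouched).  The typed tower carries the printed indices on the GEOMETRIC groups (`deltaPmHat_index : [Δ̂^cor_v : Δ̂^±_v] = 2l`,
`deltaHat_index`) and the compatibility `aug_compat` of the augmentation `Π̂^cor_v ↠ G_v` with the SURJECTIVE `Π_v ↠ G_v` of the
setting.  Consequences proved here for every inhabitant: `Π_v` (hence `Π̂_v`, `Π̂^±_v`) surjects onto `G_v` (`aug_emb_incl_surjective`),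
so `Π̂^cor_v = Δ̂^cor_v · Π_v` (`deltaCorHat_sup_piV_eq_top`, `…_hat_…`, `…_pmHat_…`) and therefore the ARITHMETIC index is the geometric
one: **`index_pmHat : W.pmHat.index = 2 * S.l`** (`[Π̂^cor_v : Π̂^±_v] = 2l`, the isomorphism `Δ̂^cor_v/Δ̂^±_v ⥲ Π̂^cor_v/Π̂^±_v` of
Def 2.3 (v) at the level of indices; `card_quotient_pmHat`).  Consumer: condition (iii) of the inhabitation criterion of the Def 2.3 (v)
successor (`FlTorsorStructureConjCriterion.lean`, p438863) holds for free.  No `def`, no instance; typed ≠ proved; no side taken on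
[IUTchIII] Cor. 3.12; nothing here asserts abc proved or refuted.
-/

namespace Literature.IUT.HodgeArakelov

universe u

namespace PlusMinusTower

variable {S : BadPlaceSetting.{u}} {P : TopGroup.{u}} {T : TemperedCoverings S P} (W : PlusMinusTower T)

/-- **`Π_v ↠ G_v` through the tower**: the composite `Π_v → Π̂^cor_v ↠ G_v` is surjective (from `aug_compat` and the surjectivity of the
setting's augmentation `Π^tp_{X̲̲_v} ↠ G_v`). [claim: Mochizuki2012, status: disputed] (IUTchII §2 Def 2.3 (i), kurims p.67) -/
theorem aug_emb_incl_surjective : Function.Surjective fun x : P => W.aug (W.emb (T.incl x)) := by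
  obtain ⟨e, he⟩ := W.aug_compat
  intro γ
  obtain ⟨y, hy⟩ := S.aug_surjective γ
  refine ⟨e.symm y, ?_⟩
  change W.aug (W.emb (T.incl (e.symm y))) = γ
  rw [he, ContinuousMulEquiv.apply_symm_apply, hy]

/-- **`Π̂^cor_v = Δ̂^cor_v · Π_v`**: `Ker(Π̂^cor_v ↠ G_v) ⊔ Π_v = ⊤`. [claim: Mochizuki2012, status: disputed] (IUTchII §2 Def 2.3 (i), kurims p.67) -/
theorem deltaCorHat_sup_piV_eq_top : W.aug.ker ⊔ W.piV = ⊤ := by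
  rw [eq_top_iff]
  intro g _
  obtain ⟨x, hx⟩ := W.aug_emb_incl_surjective (W.aug g)
  have hx' : W.aug (W.emb (T.incl x)) = W.aug g := hx
  have h1 : g * (W.emb (T.incl x))⁻¹ ∈ W.aug.ker := by
    rw [MonoidHom.mem_ker, map_mul, map_inv, hx', mul_inv_cancel]
  have h2 : W.emb (T.incl x) ∈ W.piV := ⟨x, rfl⟩
  have h := Subgroup.mul_mem _ (Subgroup.mem_sup_left h1) (Subgroup.mem_sup_right h2)
  rwa [inv_mul_cancel_right] at h

/-- `Ker(Π̂^cor_v ↠ G_v) ⊔ Π̂_v = ⊤`. [claim: Mochizuki2012, status: disputed] (IUTchII §2 Def 2.3 (i), kurims p.67) -/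
theorem deltaCorHat_sup_hat_eq_top : W.aug.ker ⊔ W.hat = ⊤ :=
  top_le_iff.mp (W.deltaCorHat_sup_piV_eq_top.symm.le.trans (sup_le_sup_left W.embP_le_hat _))

/-- `Ker(Π̂^cor_v ↠ G_v) ⊔ Π̂^±_v = ⊤`. [claim: Mochizuki2012, status: disputed] (IUTchII §2 Def 2.3 (i), kurims p.67) -/
theorem deltaCorHat_sup_pmHat_eq_top : W.aug.ker ⊔ W.pmHat = ⊤ :=
  top_le_iff.mp (W.deltaCorHat_sup_hat_eq_top.symm.le.trans (sup_le_sup_left W.hat_le_pmHat _))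

/-- `Π̂^±_v ↠ G_v` is surjective. [claim: Mochizuki2012, status: disputed] (IUTchII §2 Def 2.3 (i), kurims p.67) -/
theorem aug_surjective_of_mem_pmHat : ∀ γ : S.Gk, ∃ g ∈ W.pmHat, W.aug g = γ := fun γ => by
  obtain ⟨x, hx⟩ := W.aug_emb_incl_surjective γ
  exact ⟨W.emb (T.incl x), W.hat_le_pmHat (W.embP_le_hat ⟨x, rfl⟩), hx⟩

/-- **`[Π̂^cor_v : Π̂^±_v] = 2l`** for every `±`-tower: the arithmetic index equals the printed geometric index
`[Δ̂^cor_v : Δ̂^±_v] = 2l` because `Π̂^cor_v = Δ̂^cor_v · Π̂^±_v` and `Π̂^±_v ⊴ Π̂^cor_v` («`Δ̂^cor_v/Δ̂^±_v ⥲ Π̂^cor_v/Π̂^±_v`», Def 2.3 (v)).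
[claim: Mochizuki2012, status: disputed] (IUTchII §2 Def 2.3 (i), kurims p.67) -/
theorem index_pmHat : W.pmHat.index = 2 * S.l := by
  rw [← Subgroup.relIndex_top_right, ← W.deltaCorHat_sup_pmHat_eq_top, Subgroup.relIndex_sup_right,
    ← Subgroup.inf_relIndex_right]
  exact W.deltaPmHat_index

/-- `|Π̂^cor_v/Π̂^±_v| = 2l`. [claim: Mochizuki2012, status: disputed] (IUTchII §2 Def 2.3 (i), kurims p.67) -/
theorem card_quotient_pmHat : Nat.card (W.Corhat ⧸ W.pmHat) = 2 * S.l := by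
  rw [← Subgroup.index_eq_card]; exact W.index_pmHat

/-- `Π̂^±_v` has finite index in `Π̂^cor_v`. [claim: Mochizuki2012, status: disputed] (IUTchII §2 Def 2.3 (i), kurims p.67) -/
theorem finiteIndex_pmHat : W.pmHat.FiniteIndex :=
  ⟨by rw [W.index_pmHat]; exact mul_ne_zero two_ne_zero S.l_prime.ne_zero⟩

/-- The geometric quotient maps ONTO the arithmetic one: every class of `Π̂^cor_v/Π̂^±_v` has a representative in `Δ̂^cor_v`
(«`Δ̂^cor_v/Δ̂^±_v ⥲ Π̂^cor_v/Π̂^±_v`» as a surjection of cosets). [claim: Mochizuki2012, status: disputed] (IUTchII §2 Def 2.3 (v), kurims p.69) -/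
theorem exists_mem_ker_quotient_eq (q : W.Corhat ⧸ W.pmHat) : ∃ δ ∈ W.aug.ker, (QuotientGroup.mk δ : W.Corhat ⧸ W.pmHat) = q := by
  obtain ⟨g, rfl⟩ := QuotientGroup.mk_surjective q
  obtain ⟨h, hh, hhaug⟩ := W.aug_surjective_of_mem_pmHat (W.aug g)
  refine ⟨g * h⁻¹, ?_, ?_⟩
  · rw [MonoidHom.mem_ker, map_mul, map_inv, hhaug, mul_inv_cancel]
  · rw [QuotientGroup.eq]
    simpa using hh

end PlusMinusTower

end Literature.IUT.HodgeArakelov
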